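import Summits.QuantumFields.BalabanUV.Beta.GAN24.DressedHalfVertex
import Summits.QuantumFields.BalabanUV.Beta.GAN24.CoarseGaugeSourceResponse
import Summits.QuantumFields.BalabanUV.Beta.GAN24.FaceWeightedSandwich

/-!
# `BalabanUV.Beta.GAN24.DressedVertexFaceBondSum` — binder row G-an2-4 ∕ (CONV-C), W-slot (α-0), ROW (C) AT LEVELS `j ≥ 1`, the (γ) hand's memo
# `HOME/b2b-balaban-gan24-formalise-leaf-06/g54/C-LEVELS-GE1-g54.md` §29 («THE DEPTH TOWER», first letter): **THE BOND SUM OF THE DRESSED CHAIN-RULE VERTEX AGAINST A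
# SINGLE-COORDINATE BOND WEIGHT READS THE TABLE ON THE EXIT FACE WITH THE WEIGHT AT THE BLOCK INDEX; AGAINST THE PERIOD-`N` EXIT-FACE BOND WEIGHT IT READS THE TABLE ON
# THE DEEPER EXIT CLASS `[t_ν % Lc = Lc−1] ∧ [⌊t_ν∕Lc⌋ % N = N−1] = [t_ν % (Lc·N) = Lc·N − 1]`** — the weighted twin of leaf-04's
# `DressedHalfVertex.hasSum_vertexOfK_dressedStep` over road-P2's `CoarseGaugeSourceResponse.tsum_coord_colH` (every `j`, in-block root, all units, every local stencil family)
# (G-an2-4 CRUX TEAM (2), seat `b2b-balaban-gan24-formalise-leaf-06` = the (γ) hand, gen 54; journal INTENT I-leaf06-g54-4)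

NOT IN PRINT; OUR BOOKKEEPING ([folklore] `tsum` bookkeeping BY NAME + integer division; 0 `def`, 0 cited fact, 0 `def … : Prop`, 0 sorry).
HONEST FRAMING (cell contract, verbatim): «discharging `BetaPertH` makes Bałaban's UV stability UNCONDITIONAL — a real constructive-QFT result; it is NOT the continuum
limit and NOT the Clay problem.»  HONEST DEPENDENCY (verbatim): «continuum YM on T⁴ ⇐ BetaPertH ∧ nine spine estimates (0/9 proved); BetaPertH ⇐ (D1) ∧ (D4) ∧ CAP+tail;
G-an2-4 gates asym, D1 and NE2/3/4.»

WHY.  Road-P2's one-step charge law `T2RecChargeStepFourFace.zmode_succ_eq_fourFace` puts the CONTACT side of (C)_{j+1} on the FOUR-FACE charge of the member `T̃_j`: the member read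
with BOTH background bonds and BOTH legs on the exit faces of their own directions.  In the word expansion of the member (leaf-04's `DressedSourceZeroModeWords`) the free bond
sum `Σ_{u′} dM_{ν,u′}` is what reads the cubic table on the ν-exit face of its slot (`hasSum_vertexOfK_dressedStep`: `Σ_{u′} vertexOfK X̃♮_j Lc S ν u′ = c₀σ_j·Σ'_t χ_ν(t)·S ν t`);
the four-face charge restricts that bond sum to the ν-exit faces, `Σ_{u′} χ^N_ν(u′)·dM_{ν,u′}`, and the answer is the table read on the DEEPER class — one more factor `χ^N_ν(⌊t_ν∕Lc⌋)`,
i.e. the exit face at period `Lc·N` (§4).  With `ExitFaceSlotStaircaseDeep` (the exit-face-gated slot sums of the value third jet at any period: `½·E2_{j+1}·(⌊z_ν∕N⌋ − ⌊x_ν∕N⌋)`)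
this is the first letter of the (γ) hand's valuation of the four-face charge — the CT side of (C)_{≥1} in the same `⟨q, E2 q⟩` currency as the exchange word.
* §1 **the row-weighted kernel** `K_f w z g b := (Sum.elim (fun _ ↦ f((blk Lc z)_ν)) 0 g)·X w z g b` (an inline lambda, no `def`): `decays_rowWeight` (bounded `f`),
  **`vertexOfK_rowWeight`**: `vertexOfK K_f Lc S ν u′ = f(u′_ν)·vertexOfK X Lc S ν u′` entrywise (`blk Lc (Lc•u′) = u′`).
* §2 **`hasSum_dressedStep_col_coordWeight`**: the single-coordinate-weighted column charge of the dressed step `X̃♮_j = unitK s_f s_m G_j` —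
  `HasSum (z′ ↦ K_f w (Lc•z′) g (inr ν)) (g = inl κ ↦ [κ = ν ∧ w_ν % Lc = Lc−1]·(s_f s_m)·cH_j·f(⌊w_ν∕Lc⌋); inr ↦ 0)` (`tsum_coord_colH`, `cH_j = (stepScale_j·Lc^{d+1})⁻¹`).
* §3 **`hasSum_vertexOfK_dressedStep_coordWeight`** (local `S` at a positive rate, any legs):
  `HasSum (u′ ↦ f(u′_ν)·vertexOfK X̃♮_j Lc S ν u′ p q c e) ((s_f s_m)·cH_j·Σ'_t [t_ν % Lc = Lc−1]·f(⌊t_ν∕Lc⌋)·S ν t p q c e)` (leaf-04's `hasSum_vertexOfK_bond_site` at `K_f`).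
* §4 (leaf-04 g62's two-scale exit-face condition `FaceWeightedSandwich.emod_mul_eq_iff`: `t % (Lc·N) = Lc·N − 1 ↔ t % Lc = Lc − 1 ∧ (t ∕ Lc) % N = N − 1`, BY NAME) **`tsum_faceBond_vertexOfK_dressedStep`**:
  `Σ'_{u′} [u′_ν % N = N−1]·vertexOfK X̃♮_j Lc S ν u′ p q c e = (s_f s_m)·cH_j·Σ'_t [t_ν % (Lc·N) = Lc·N − 1]·S ν t p q c e` — THE DEEPER CLASS.
Asserts NO value of Bałaban's tables; discharges NOTHING of (C) ∕ (C)sym ∕ (Q-L) ∕ «T2Shape» ∕ «T2Drift» ∕ (hW, hWall); NEVER «G-an2-4 closed» as (CONV-C); NOT D1, NOT `BetaPertH`,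
NOT continuum, NOT Clay.  2026-08-24; no existing file touched.
-/

noncomputable section

open Finset
open scoped BigOperators
open Literature.MathematicalPhysics.QuantumFieldTheory
open Literature.MathematicalPhysics.QuantumFieldTheory.Balaban1983to89
open Literature.MathematicalPhysics.QuantumFieldTheory.Balaban1983to89.Beta
open B12Sec2to5 (l1 l1_nonneg)
open ExpKernelCalculus (Site MKer Decays)
open OneStepResolventKernel (Fib LocStencil wsum decays_mono)
open BalabanStepJets (locStencil_mono)
open OneStepKernelFamily (KInvStep decays_KInvStep colH vertexOfK)
open AffineAveraging (box toSite)
open AveragingContours (blk)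
open AxialProjector (blk_zsmul)
open Summit.QuantumFields.BalabanUV.Beta.AxialDressingRooted (coDressKBmAt decays_coDressKBmAt)
open Summit.QuantumFields.BalabanUV.Beta.BorderedHessian (stepScale)
open Summit.QuantumFields.BalabanUV.Beta.HessKerDressedUnits (unitK unitK_apply legScale_inl legScale_inr decays_unitK)
open Summit.QuantumFields.BalabanUV.Beta.GAN24.DressedHalfVertex (hasSum_vertexOfK_bond_site)
open Summit.QuantumFields.BalabanUV.Beta.GAN24.CoarseGaugeSourceResponse (summable_bdd_mul summable_source_colH tsum_coord_colH)
open Summit.QuantumFields.BalabanUV.Beta.GAN24.FaceWeightedSandwich (emod_mul_eq_iff)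

namespace Summit.QuantumFields.BalabanUV.Beta.GAN24.DressedVertexFaceBondSum

variable {d : ℕ} {Lc : ℕ} [NeZero Lc]

/-! ## §1 The row-weighted kernel -/

section Weight

variable {X : MKer (d + 1) (Fib d)} {f : ℤ → ℝ} {B : ℝ} (ν : Fin (d + 1))

omit [NeZero Lc] in
/-- [folklore] The single-coordinate weight on the fibre: `inl ↦ f((blk Lc z)_ν)`, `inr ↦ 0`; bounded by `B` when `|f| ≤ B`. -/
theorem abs_weight_le (hf : ∀ s, |f s| ≤ B) (z : Site (d + 1)) (g : Fib d) :
    |Sum.elim (fun _ : Fin (d + 1) => f (blk Lc z ν)) (fun _ : Fin (d + 1) => (0 : ℝ)) g| ≤ B := by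
  have hB : 0 ≤ B := (abs_nonneg _).trans (hf 0)
  rcases g with a | m
  · exact hf _
  · simp [hB]

omit [NeZero Lc] in
/-- [folklore] **THE ROW-WEIGHTED KERNEL DECAYS** at the same rate with constant `B·C`. -/
theorem decays_rowWeight {C m : ℝ} (hX : Decays X C m) (hf : ∀ s, |f s| ≤ B) :
    Decays (fun w z g b => Sum.elim (fun _ : Fin (d + 1) => f (blk Lc z ν)) (fun _ : Fin (d + 1) => (0 : ℝ)) g * X w z g b) (B * C) m := by
  intro w z g b
  rw [abs_mul, mul_assoc]
  exact mul_le_mul (abs_weight_le (Lc := Lc) ν hf z g) (hX w z g b) (abs_nonneg _) ((abs_nonneg _).trans (hf 0))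

omit [NeZero Lc] in
/-- [folklore] **THE CHAIN-RULE VERTEX OF THE ROW-WEIGHTED KERNEL IS THE WEIGHT AT THE BOND TIMES THE VERTEX** (`1 ≤ Lc`; the vertex only reads the field rows of the
`ℋ`-column at the base point `Lc•u′`, where the weight is `f(u′_ν)`). -/
theorem vertexOfK_rowWeight (hLc : 1 ≤ Lc) (f : ℤ → ℝ) (S : Fin (d + 1) → (Fin (d + 1) → ℤ) → MKer (d + 1) (Fib d))
    (u' p q : Site (d + 1)) (c e : Fib d) :
    vertexOfK (fun w z g b => Sum.elim (fun _ : Fin (d + 1) => f (blk Lc z ν)) (fun _ : Fin (d + 1) => (0 : ℝ)) g * X w z g b) Lc S ν u' p q c e =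
      f (u' ν) * vertexOfK X Lc S ν u' p q c e := by
  simp only [vertexOfK, wsum, colH, Sum.elim_inl, blk_zsmul hLc]
  rw [Finset.mul_sum]
  refine Finset.sum_congr rfl fun κ _ => ?_
  rw [← tsum_mul_left]
  refine tsum_congr fun t => ?_
  ring

end Weight

/-! ## §2 The single-coordinate-weighted column charge of the dressed step -/

section Step

variable {r : Fin (d + 1) → ℕ}

/-- [folklore] **THE WEIGHTED COLUMN CHARGE OF THE DRESSED STEP** (in-block root, every `j`, all units, bounded `f`): for every fibre `g` and fine row `w`,
`HasSum (z′ ↦ K_f w (Lc•z′) g (inr ν)) (g = inl κ ↦ [κ = ν ∧ w_ν % Lc = Lc−1]·(s_f s_m)·cH_j·f(⌊w_ν∕Lc⌋); g = inr m ↦ 0)` — `CoarseGaugeSourceResponse.tsum_coord_colH`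
through the units (`unitK_apply`); the multiplier rows carry the weight `0`. -/
theorem hasSum_dressedStep_col_coordWeight (hr : r ∈ box (d + 1) Lc) (sf sm : ℝ) (j : ℕ) (ν : Fin (d + 1)) (f : ℤ → ℝ) {B : ℝ} (hf : ∀ s, |f s| ≤ B)
    (g : Fib d) (w : Site (d + 1)) :
    HasSum (fun z' : Site (d + 1) => Sum.elim (fun _ : Fin (d + 1) => f (blk Lc ((Lc : ℤ) • z') ν)) (fun _ : Fin (d + 1) => (0 : ℝ)) g *
        unitK sf sm (coDressKBmAt (toSite r) Lc (KInvStep (d := d) Lc j)) w ((Lc : ℤ) • z') g (Sum.inr ν))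
      (Sum.elim (fun κ => if κ = ν ∧ w ν % (Lc : ℤ) = (Lc : ℤ) - 1 then (sf * sm) * ((stepScale d Lc j * (Lc : ℝ) ^ (d + 1))⁻¹ * f (blk Lc w ν)) else 0)
        (fun _ => (0 : ℝ)) g) := by
  classical
  have hLc : 1 ≤ Lc := Nat.one_le_iff_ne_zero.2 (NeZero.ne Lc)
  rcases g with κ | m
  · simp only [Sum.elim_inl, blk_zsmul hLc, unitK_apply, legScale_inl, legScale_inr]
    have e : ∀ z' : Site (d + 1), f (z' ν) * (sf * coDressKBmAt (toSite r) Lc (KInvStep (d := d) Lc j) w ((Lc : ℤ) • z') (Sum.inl κ) (Sum.inr ν) * sm) =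
        (sf * sm) * (f (z' ν) * colH (coDressKBmAt (toSite r) Lc (KInvStep (d := d) Lc j)) Lc ν z' κ w) := by
      intro z'; simp only [colH]; ring
    simp_rw [e]
    have hs : Summable fun z' : Site (d + 1) => f (z' ν) * colH (coDressKBmAt (toSite r) Lc (KInvStep (d := d) Lc j)) Lc ν z' κ w :=
      summable_bdd_mul (summable_source_colH r j ν κ w) (fun z' => hf (z' ν))
    have h := (hs.hasSum).mul_left (sf * sm)
    rw [tsum_coord_colH hr j ν f hf κ w] at h
    have hv : (sf * sm) * ((stepScale d Lc j * (Lc : ℝ) ^ (d + 1))⁻¹ * (if κ = ν ∧ w ν % (Lc : ℤ) = (Lc : ℤ) - 1 then f (blk Lc w ν) else 0)) =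
        (if κ = ν ∧ w ν % (Lc : ℤ) = (Lc : ℤ) - 1 then (sf * sm) * ((stepScale d Lc j * (Lc : ℝ) ^ (d + 1))⁻¹ * f (blk Lc w ν)) else 0) := by
      split_ifs <;> ring
    rw [hv] at h
    exact h
  · simp only [Sum.elim_inr, zero_mul]
    exact hasSum_zero

/-! ## §3 The weighted bond sum of the dressed chain-rule vertex -/

/-- [folklore] **THE SINGLE-COORDINATE-WEIGHTED BOND SUM OF THE DRESSED CHAIN-RULE VERTEX** (in-block root, `1 ≤ Lc`, every `j`, all units, bounded `f`, local `S`):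
`HasSum (u′ ↦ f(u′_ν)·vertexOfK X̃♮_j Lc S ν u′ p q c e) ((s_f s_m)·cH_j·Σ'_t [t_ν % Lc = Lc−1]·f(⌊t_ν∕Lc⌋)·S ν t p q c e)` — leaf-04's `hasSum_vertexOfK_bond_site` at the
row-weighted kernel (§1–§2).  At `f ≡ 1` this is `hasSum_vertexOfK_dressedStep`. -/
theorem hasSum_vertexOfK_dressedStep_coordWeight (hLc : 1 ≤ Lc) (hr : r ∈ box (d + 1) Lc) (sf sm : ℝ) (j : ℕ) (ν : Fin (d + 1))
    (f : ℤ → ℝ) {B : ℝ} (hf : ∀ s, |f s| ≤ B)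
    {S : Fin (d + 1) → Site (d + 1) → MKer (d + 1) (Fib d)} {Cs δs : ℝ} (hS : LocStencil S Cs δs) (hδs : 0 < δs)
    (p q : Site (d + 1)) (c e : Fib d) :
    HasSum (fun u' : Site (d + 1) => f (u' ν) * vertexOfK (unitK sf sm (coDressKBmAt (toSite r) Lc (KInvStep (d := d) Lc j))) Lc S ν u' p q c e)
      ((sf * sm) * ((stepScale d Lc j * (Lc : ℝ) ^ (d + 1))⁻¹ *
        ∑' t : Site (d + 1), (if t ν % (Lc : ℤ) = (Lc : ℤ) - 1 then f (t ν / (Lc : ℤ)) * S ν t p q c e else 0))) := by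
  classical
  obtain ⟨δ, C', hδ, hC', hK'⟩ := decays_coDressKBmAt hLc hr (decays_KInvStep (d := d) (Lc := Lc) j)
  have hKu : Decays (unitK sf sm (coDressKBmAt (toSite r) Lc (KInvStep (d := d) Lc j))) (max |sf| |sm| * C' * max |sf| |sm|) δ := decays_unitK hK'
  have hCs : 0 ≤ Cs := (hS 0 0).nonneg (Sum.inl 0)
  have hCu : 0 ≤ max |sf| |sm| * C' * max |sf| |sm| := hKu.nonneg (Sum.inl 0)
  set m : ℝ := min δ δs with hm
  have hm0 : 0 < m := lt_min hδ hδs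
  have hKm : Decays (unitK sf sm (coDressKBmAt (toSite r) Lc (KInvStep (d := d) Lc j))) (max |sf| |sm| * C' * max |sf| |sm|) m :=
    decays_mono hKu hCu le_rfl (min_le_left _ _)
  have hKf := decays_rowWeight (Lc := Lc) (f := f) ν hKm hf
  have hSm : LocStencil S Cs m := locStencil_mono hS hCs (min_le_right _ _)
  have h := hasSum_vertexOfK_bond_site (N := Lc)
    (K := fun w z g b => Sum.elim (fun _ : Fin (d + 1) => f (blk Lc z ν)) (fun _ : Fin (d + 1) => (0 : ℝ)) g *
      unitK sf sm (coDressKBmAt (toSite r) Lc (KInvStep (d := d) Lc j)) w z g b) hKf hm0 ν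
    (ρR := fun g w => Sum.elim (fun κ => if κ = ν ∧ w ν % (Lc : ℤ) = (Lc : ℤ) - 1 then
      (sf * sm) * ((stepScale d Lc j * (Lc : ℝ) ^ (d + 1))⁻¹ * f (blk Lc w ν)) else 0) (fun _ => (0 : ℝ)) g)
    (fun g w => hasSum_dressedStep_col_coordWeight (d := d) hr sf sm j ν f hf g w) hSm p q c e
  -- the value: only the colour `κ = ν` survives
  have hv : (∑ κ : Fin (d + 1), ∑' t : Site (d + 1), Sum.elim (fun κ : Fin (d + 1) => if κ = ν ∧ t ν % (Lc : ℤ) = (Lc : ℤ) - 1 then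
      (sf * sm) * ((stepScale d Lc j * (Lc : ℝ) ^ (d + 1))⁻¹ * f (blk Lc t ν)) else 0) (fun _ : Fin (d + 1) => (0 : ℝ)) (Sum.inl κ : Fib d) * S κ t p q c e) =
      (sf * sm) * ((stepScale d Lc j * (Lc : ℝ) ^ (d + 1))⁻¹ *
        ∑' t : Site (d + 1), (if t ν % (Lc : ℤ) = (Lc : ℤ) - 1 then f (t ν / (Lc : ℤ)) * S ν t p q c e else 0)) := by
    simp only [Sum.elim_inl]
    rw [Finset.sum_eq_single ν]
    · rw [← mul_assoc, ← tsum_mul_left]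
      refine tsum_congr fun t => ?_
      simp only [true_and, blk]
      split_ifs <;> ring
    · intro κ _ hκ
      simp [hκ]
    · intro hν
      exact absurd (Finset.mem_univ ν) hν
  rw [hv] at h
  refine h.congr_fun fun u' => ?_
  exact (vertexOfK_rowWeight (Lc := Lc) ν hLc f S u' p q c e).symm

/-! ## §4 The period-`N` exit-face bond weight: the deeper exit class -/

/-- [folklore] **THE PERIOD-`N` EXIT-FACE BOND SUM OF THE DRESSED CHAIN-RULE VERTEX READS THE TABLE ON THE DEEPER EXIT CLASS** (in-block root, `1 ≤ Lc`, `1 ≤ N`, every `j`,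
all units, local `S`, any legs): `Σ'_{u′} [u′_ν % N = N−1]·vertexOfK X̃♮_j Lc S ν u′ p q c e = (s_f s_m)·cH_j·Σ'_t [t_ν % (Lc·N) = Lc·N − 1]·S ν t p q c e`
(§3 at the bounded weight `f = χ^N`, then leaf-04's `FaceWeightedSandwich.emod_mul_eq_iff`).  At `N = 1` the weight is `1` and the class is the plain exit face (leaf-04's `hasSum_vertexOfK_dressedStep`);
at `N = Lc^m` it is the class `exit^{Lc^{m+1}}` of road-P2's tower (`CoarseGaugeSourceResponse` §4). -/
theorem tsum_faceBond_vertexOfK_dressedStep (hLc : 1 ≤ Lc) (hr : r ∈ box (d + 1) Lc) (sf sm : ℝ) (j : ℕ) (ν : Fin (d + 1)) {N : ℕ} (hN : 1 ≤ N)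
    {S : Fin (d + 1) → Site (d + 1) → MKer (d + 1) (Fib d)} {Cs δs : ℝ} (hS : LocStencil S Cs δs) (hδs : 0 < δs)
    (p q : Site (d + 1)) (c e : Fib d) :
    ∑' u' : Site (d + 1), (if u' ν % (N : ℤ) = (N : ℤ) - 1 then (1 : ℝ) else 0) *
        vertexOfK (unitK sf sm (coDressKBmAt (toSite r) Lc (KInvStep (d := d) Lc j))) Lc S ν u' p q c e =
      (sf * sm) * ((stepScale d Lc j * (Lc : ℝ) ^ (d + 1))⁻¹ *
        ∑' t : Site (d + 1), (if t ν % ((Lc : ℤ) * (N : ℤ)) = (Lc : ℤ) * (N : ℤ) - 1 then S ν t p q c e else 0)) := by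
  classical
  have hf : ∀ s : ℤ, |(fun s : ℤ => if s % (N : ℤ) = (N : ℤ) - 1 then (1 : ℝ) else 0) s| ≤ 1 := fun s => by
    simp only; split_ifs <;> simp
  have h := (hasSum_vertexOfK_dressedStep_coordWeight hLc hr sf sm j ν (fun s : ℤ => if s % (N : ℤ) = (N : ℤ) - 1 then (1 : ℝ) else 0) hf hS hδs p q c e).tsum_eq
  rw [h]
  congr 1
  congr 1
  refine tsum_congr fun t => ?_
  have hLc0 : (0 : ℤ) < Lc := by exact_mod_cast hLc
  have hN0 : (0 : ℤ) < N := by exact_mod_cast hN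
  have key := emod_mul_eq_iff hLc0 hN0 (t ν)
  by_cases h1 : t ν % (Lc : ℤ) = (Lc : ℤ) - 1
  · by_cases h2 : t ν / (Lc : ℤ) % (N : ℤ) = (N : ℤ) - 1
    · rw [if_pos h1, if_pos h2, if_pos (key.2 ⟨h1, h2⟩), one_mul]
    · rw [if_pos h1, if_neg h2, if_neg (fun h => h2 (key.1 h).2), zero_mul]
  · rw [if_neg h1, if_neg (fun h => h1 (key.1 h).1)]

end Step

end Summit.QuantumFields.BalabanUV.Beta.GAN24.DressedVertexFaceBondSum

end
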